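import Literature.NumberTheory.Automorphic.BockleHuiIrreducibleGL3WeightProofs
import HarnessLib

/-!
# The analytic package of `L^S(s, π₁ × π₂)` for two cuspidal Borel–Jacquet data of the SAME rank
# (Arthur–Clozel, Ch. 3, (2.1)–(2.3)) — proofs only

Topic `NumberTheory/Automorphic`; namespace `Literature.NumberTheory.Automorphic`.  PROOFS file
(theorems only: no definition, no named fact, no `sorry`).  The equal-rank companion of
`analyticPackage_repData` / `analyticPackage_dual` (`BockleHuiIrreducibleGL3NoContragredientProofs`,
the `GL_n × GL_1` packages, where `X = ∅` because `n ≠ 1`): for cuspidal Borel–Jacquet data `π₁`, `π₂`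
on `GL_n(𝔸_F)` (`n ≥ 1`, `CuspidalAutomorphicRepData n F hF`) with Satake families `β₁`, `β₂` at almost
all places which are UNITARY almost everywhere (`|det t_{π_i,w}| = 1`), there is a finite set `S₀` of
finite places such that for every finite `S ⊇ S₀` the partial Rankin–Selberg `L`-function
`L^S(s, π₁ × π₂) = partialPairL S β₁ β₂ s = ∏_{v ∉ S} det(1 - t_{π₁,v} ⊗ t_{π₂,v} q_v^{-s})⁻¹`

* is a multipliable Euler product at every `s` with `Re s > 1` — (2.1), Jacquet–Shalika I, Thm. 5.3,
  a THEOREM of the tree (`JacquetShalika1981_multipliable_partialPairL_repData_holds`);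
* is continuous and non-zero at every `s` with `Re s > 1` — Jacquet–Shalika I, Thm. 5.3, a THEOREM of
  the tree (`continuousAt_and_ne_zero_partialPairL_repData`);
* has a SIMPLE POLE at `s = 1` with non-zero residue, `(s - 1) L^S(s, π₁ × π₂) → c ≠ 0` as `s → 1`,
  `Re s > 1`, when `1 ∈ X`, i.e. when `t_{π₁,w} = t_{π₂,w}⁻¹` for almost all `w` (the Hecke-matrix
  form of `π₁ ≅ π₂^∨`) — (2.3), granted as the named fact
  `JacquetShalika1981_partialPairL_pole_repData` (a hypothesis here);
* has a finite NON-ZERO limit as `s → 1`, `Re s > 1`, when `1 ∉ X` — (2.2), granted as the named fact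
  `JacquetShalika1981_partialPairL_boundary_repData` (a hypothesis here).

The two named facts are stated at a general boundary point `s₀`, `Re s₀ = 1`, with the twist
`q_w^{1 - s₀} t_{π₁,w}`; at `s₀ = 1` the twist is trivial (`q_w^{0} = 1`), which is the only
computation in this file (`analyticPackage_pair`).  The exceptional set `S₀` is the union of the four
exceptional sets of (2.1), (5.3), (2.2), (2.3) and of the finite set where one of the four
almost-everywhere hypotheses fails (`Filter.eventually_cofinite`).

Used by the `(2,2)` case of the reducibility analysis of the exterior-square ascent on `GL₄`
(`Summits/Langlands`), whose twelve-factor identity of partial Rankin–Selberg `L`-functions has three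
`GL₄ × GL₄` factors.

What is NOT here: the `GL_n × GL_m` package for `n ≠ m` (`X = ∅`; for `m = 1` it is
`analyticPackage_repData`), and any discharge of (2.2)/(2.3).

## References

* J. Arthur, L. Clozel, *Simple algebras, base change, and the advanced theory of the trace
  formula*, Ann. of Math. Stud. 120 (1989), Ch. 3 §2, (2.1)–(2.3), p. 171. [ArthurClozelAMS120]
* H. Jacquet, J. A. Shalika, *On Euler products and the classification of automorphic
  representations I, II*, Amer. J. Math. 103 (1981), I Thm. (5.3); II Prop. 3.6, Thm. 4.4.
  [JacquetShalikaAJM1981] [JacquetShalikaAJM1981II]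
-/

noncomputable section

open scoped Topology Classical NumberField
open NumberField IsDedekindDomain Filter Polynomial

namespace Literature.NumberTheory.Automorphic

/-- At the boundary point `s₀ = 1` the twist `q_w^{1 - s₀} t_w` of (2.2)/(2.3) is `t_w` itself.
[folklore] -/
private theorem map_residueCard_cpow_one_sub_one_mul {F : Type} [Field F] [NumberField F]
    (w : HeightOneSpectrum (𝓞 F)) (t : Multiset ℂ) :
    t.map ((((w.residueCard : ℂ)) ^ ((1 : ℂ) - 1)) * ·) = t := by
  rw [sub_self, Complex.cpow_zero]
  simp

/-- **The analytic package of `L^S(s, π₁ × π₂)` in equal rank (Arthur–Clozel, Ch. 3, (2.1)–(2.3)).**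
For cuspidal Borel–Jacquet data `π₁`, `π₂` on `GL_n(𝔸_F)` (`n ≥ 1`) with Satake families `β₁`, `β₂`
at almost all places, unitary almost everywhere (`|det t_{π_i,w}| = 1`), and granting Jacquet–Shalika
(2.2) and (2.3) for Borel–Jacquet data: there is a finite `S₀` such that for every finite `S ⊇ S₀`
the Euler product `L^S(s, π₁ × π₂) = partialPairL S β₁ β₂ s` is multipliable at every `s` with
`Re s > 1` ((2.1), the theorem `JacquetShalika1981_multipliable_partialPairL_repData_holds`), continuous
and non-zero there (Jacquet–Shalika I, Thm. 5.3, the theorem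
`continuousAt_and_ne_zero_partialPairL_repData`), has a simple pole with non-zero residue at `s = 1`
("the limit `lim_{s → 1, Re s > 1} (s - 1) L^S(s, π₁ × π₂)` exists and is finite and non-zero") if
`t_{π₁,w} = t_{π₂,w}⁻¹` for almost all `w` ((2.3) at `s₀ = 1`), and a finite non-zero limit as
`s → 1`, `Re s > 1`, otherwise ((2.2) at `s₀ = 1 ∉ X`).
[cite: ArthurClozelAMS120, Ch. 3 §2 (2.1)–(2.3)] -/
theorem analyticPackage_pair :
    ∀ (F : Type) [Field F] [NumberField F] (n : ℕ) [NeZero n]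
      (hF : isCompact_glFiniteIntegralLevel n F),
      JacquetShalika1981_partialPairL_boundary_repData →
      JacquetShalika1981_partialPairL_pole_repData →
      ∀ (P₁ P₂ : CuspidalAutomorphicRepData n F hF) (β₁ β₂ : SatakeFamily F),
        (∀ᶠ w : HeightOneSpectrum (𝓞 F) in cofinite, P₁.1.HasSatakeParamAt w (β₁ w)) →
        (∀ᶠ w : HeightOneSpectrum (𝓞 F) in cofinite, P₂.1.HasSatakeParamAt w (β₂ w)) →
        (∀ᶠ w : HeightOneSpectrum (𝓞 F) in cofinite, ‖(β₁ w).prod‖ = 1) →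
        (∀ᶠ w : HeightOneSpectrum (𝓞 F) in cofinite, ‖(β₂ w).prod‖ = 1) →
        ∃ S₀ : Set (HeightOneSpectrum (𝓞 F)), S₀.Finite ∧
          ∀ (S : Set (HeightOneSpectrum (𝓞 F))), S.Finite → S₀ ⊆ S →
            (∀ s : ℂ, 1 < s.re → Multipliable fun v : {v : HeightOneSpectrum (𝓞 F) // v ∉ S} =>
              ((satakePairPolynomial (β₁ v.1) (β₂ v.1)).eval ((v.1.residueCard : ℂ) ^ (-s)))⁻¹) ∧
            (∀ s : ℂ, 1 < s.re →
              ContinuousAt (partialPairL S β₁ β₂) s ∧ partialPairL S β₁ β₂ s ≠ 0) ∧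
            ((∀ᶠ w : HeightOneSpectrum (𝓞 F) in cofinite, β₁ w = (β₂ w).map (·⁻¹)) →
              ∃ c : ℂ, c ≠ 0 ∧ Tendsto (fun s : ℂ => (s - 1) * partialPairL S β₁ β₂ s)
                (𝓝[{s : ℂ | 1 < s.re}] 1) (𝓝 c)) ∧
            ((¬ ∀ᶠ w : HeightOneSpectrum (𝓞 F) in cofinite, β₁ w = (β₂ w).map (·⁻¹)) →
              ∃ c : ℂ, c ≠ 0 ∧ Tendsto (partialPairL S β₁ β₂) (𝓝[{s : ℂ | 1 < s.re}] 1) (𝓝 c)) := by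
  intro F _ _ n _ hF hJ2 hJ3 P₁ P₂ β₁ β₂ hP₁ hP₂ hu₁ hu₂
  -- the exceptional sets of (2.1), (5.3), (2.2), (2.3) for the pair `(π₁, π₂)`
  obtain ⟨S₁, hS₁, hJ1a⟩ := JacquetShalika1981_multipliable_partialPairL_repData_holds n n F hF hF
    (NeZero.pos n) (NeZero.pos n) P₁ P₂
  obtain ⟨S₂, hS₂, hIa⟩ := continuousAt_and_ne_zero_partialPairL_repData P₁ P₂
  obtain ⟨S₃, hS₃, hJ2a⟩ := hJ2 n n F hF hF (NeZero.pos n) (NeZero.pos n) P₁ P₂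
  obtain ⟨S₄, hS₄, hJ3a⟩ := hJ3 n F hF (NeZero.pos n) P₁ P₂
  -- the finite set where one of the four almost-everywhere hypotheses fails
  have hgood : ∀ᶠ w : HeightOneSpectrum (𝓞 F) in cofinite, P₁.1.HasSatakeParamAt w (β₁ w) ∧
      P₂.1.HasSatakeParamAt w (β₂ w) ∧ ‖(β₁ w).prod‖ = 1 ∧ ‖(β₂ w).prod‖ = 1 := by
    filter_upwards [hP₁, hP₂, hu₁, hu₂] with w h₁ h₂ h₃ h₄
    exact ⟨h₁, h₂, h₃, h₄⟩
  obtain ⟨E, hE, hgoodE⟩ : ∃ E : Set (HeightOneSpectrum (𝓞 F)), E.Finite ∧ ∀ w ∉ E,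
      P₁.1.HasSatakeParamAt w (β₁ w) ∧ P₂.1.HasSatakeParamAt w (β₂ w) ∧ ‖(β₁ w).prod‖ = 1 ∧
        ‖(β₂ w).prod‖ = 1 :=
    ⟨_, Filter.eventually_cofinite.1 hgood, fun w hw => not_not.1 hw⟩
  refine ⟨S₁ ∪ S₂ ∪ S₃ ∪ S₄ ∪ E, (((hS₁.union hS₂).union hS₃).union hS₄).union hE, ?_⟩
  intro S hS hS₀
  have sub₁ : S₁ ⊆ S := fun x hx => hS₀ (by simp [hx])
  have sub₂ : S₂ ⊆ S := fun x hx => hS₀ (by simp [hx])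
  have sub₃ : S₃ ⊆ S := fun x hx => hS₀ (by simp [hx])
  have sub₄ : S₄ ⊆ S := fun x hx => hS₀ (by simp [hx])
  have subE : E ⊆ S := fun x hx => hS₀ (by simp [hx])
  have hES : ∀ w ∉ S, w ∉ E := fun w hw h => hw (subE h)
  -- the hypotheses off `S`
  have hP₁S : ∀ w ∉ S, P₁.1.HasSatakeParamAt w (β₁ w) := fun w hw => (hgoodE w (hES w hw)).1
  have hP₂S : ∀ w ∉ S, P₂.1.HasSatakeParamAt w (β₂ w) := fun w hw => (hgoodE w (hES w hw)).2.1
  have hu₁S : ∀ w ∉ S, ‖(β₁ w).prod‖ = 1 := fun w hw => (hgoodE w (hES w hw)).2.2.1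
  have hu₂S : ∀ w ∉ S, ‖(β₂ w).prod‖ = 1 := fun w hw => (hgoodE w (hES w hw)).2.2.2
  refine ⟨fun s hs => hJ1a hS sub₁ hP₁S hP₂S hu₁S hu₂S hs,
    fun s hs => hIa hS sub₂ hP₁S hP₂S hu₁S hu₂S hs, fun hX => ?_, fun hX => ?_⟩
  · -- (2.3) at `s₀ = 1 ∈ X`: the simple pole
    obtain ⟨c, hc, h⟩ := hJ3a hS sub₄ hP₁S hP₂S hu₁S hu₂S Complex.one_re
      (hX.mono fun w hw => by rwa [map_residueCard_cpow_one_sub_one_mul])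
    exact ⟨c, hc, h⟩
  · -- (2.2) at `s₀ = 1 ∉ X`: the finite non-zero boundary value
    obtain ⟨c, hc, h⟩ := hJ2a hS sub₃ hP₁S hP₂S hu₁S hu₂S Complex.one_re
      (fun h => hX (h.2.mono fun w hw => by rwa [map_residueCard_cpow_one_sub_one_mul] at hw))
    exact ⟨c, hc, h⟩

end Literature.NumberTheory.Automorphic
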